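import Literature.Computability.AlgebraicComplexity.KRSTSuccinctness
import HarnessLib

/-!
# KRST §3.4, continued: size and degree of the `VNP`-succinctness witness, packaged over `Fin u`

Continuation of `KRSTSuccinctness.lean` (the Boolean-sum identity `sum_aeval_witness`). Here:
`complexity_witness_le` / `totalDegree_witness_le` — explicit polynomial bounds
`witnessBound n K p M`, `witnessDegBound n K p M` for the witness
`[Σ μ_i(t) ≤ n] · Mon(t, x) · g_M(Sel(t, y)∘pad, s)` (from the gadget bounds of
`KRSTSelection.lean`, the tree's `complexity_selProd_le`, `complexity_perVNPWitness_le`,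
`complexity_aeval_le`); and `exists_boolSum_eq_target` — with `u = nK + M` Boolean variables
enumerated by `Fin u`, ONE polynomial `H ∈ F[x ⊕ Fin u]` with `boolSum H = Σ_{|μ|≤n}
Perm_[p](y∘S_μ) x^μ`, `L(H) ≤ witnessBound`, `deg H ≤ witnessDegBound` (KRST: "`F_{n,a,p}` is in
VNP … as `Perm_p` is in VNP and `Mon`, `Sel` are efficiently computable", §3.4).

## References

* [KumarRamyaSaptharishiTengse2022] M. Kumar, C. Ramya, R. Saptharishi, A. Tengse, *If VNP is
  hard, then so are equations for it*, STACS 2022, §3.4.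
-/

noncomputable section

namespace Literature.Computability.AlgebraicComplexity

open Literature.Barriers.ValiantsHypothesis MvPolynomial Finset CircuitArith BoolGadgets

namespace KRSTSucc

section Bounds

variable {F : Type*} [Field F] {n K M p : ℕ} [Fact p.Prime] (hmp : M * M ≤ p)
  (y : ZMod p × ZMod p → F)

/-! #### Size and degree of the witness -/

omit [Fact p.Prime] in
/-- `L(x^j) ≤ j`. [folklore] -/
private theorem complexity_X_pow_le' {σ : Type*} (v : σ) (j : ℕ) :
    complexity (X v ^ j : MvPolynomial σ F) ≤ j := by
  rw [Finset.pow_eq_prod_const]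
  refine (complexity_finset_prod_le _ _).trans ?_
  rw [Finset.sum_eq_zero fun _ _ => complexity_X_holds (k := F) (σ := σ) v, Finset.card_range,
    zero_add]

/-- The size bound of the witness (a polynomial in `n, K, 2^K, p, M`).
[cite: KumarRamyaSaptharishiTengse2022, §3.4] -/
def witnessBound (n K p M : ℕ) : ℕ :=
  ((n * 2 ^ K + 1) * (2 * (n * 2 ^ K) + 2) + 2 * (n * K)) + (n * K * 2 ^ K + 5 * (n * K)) + 1 +
    ((3 * M + (M * (2 * M) + M) + 1) +
      (M * M * (p * ((n * 2 ^ K * p + 1) * (2 * (n * 2 ^ K * p) + 2) + 2 * (n * K) + 1) + p))) + 1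

/-- The degree bound of the witness. [cite: KumarRamyaSaptharishiTengse2022, §3.4] -/
def witnessDegBound (n K p M : ℕ) : ℕ :=
  n * 2 ^ K + n * K * (1 + 2 ^ K) + 3 * M * (n * 2 ^ K * p + 1)

/-- `L(Mon) ≤ nK 2^K + 5 nK`. [cite: KumarRamyaSaptharishiTengse2022, Observation 9] -/
theorem complexity_monSel_le :
    complexity (monSel F : MvPolynomial (Var n K M) F) ≤ n * K * 2 ^ K + 5 * (n * K) := by
  unfold monSel
  refine (complexity_selProd_le _ _).trans ?_
  refine Nat.add_le_add_right ?_ _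
  calc _ ≤ ∑ _l : Fin (n * K), 2 ^ K := by
        refine Finset.sum_le_sum fun l _ => ?_
        rw [complexity_X_holds, mul_zero, zero_add]
        exact (complexity_X_pow_le' _ _).trans
          (Nat.pow_le_pow_right (by norm_num) (finProdFinEquiv.symm l).2.2.le)
    _ = n * K * 2 ^ K := by simp

/-- `deg(Mon) ≤ nK (1 + 2^K)`. [cite: KumarRamyaSaptharishiTengse2022, Observation 9] -/
theorem totalDegree_monSel_le :
    (monSel F : MvPolynomial (Var n K M) F).totalDegree ≤ n * K * (1 + 2 ^ K) := by
  unfold monSel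
  refine (totalDegree_selProd_le _ _).trans ?_
  calc _ ≤ ∑ _l : Fin (n * K), (1 + 2 ^ K) := by
        refine Finset.sum_le_sum fun l _ => add_le_add (isHomogeneous_X F _).totalDegree_le ?_
        refine (totalDegree_pow _ _).trans ?_
        calc 2 ^ ((finProdFinEquiv.symm l).2 : ℕ) * (X (Sum.inl (finProdFinEquiv.symm l).1) :
              MvPolynomial (Var n K M) F).totalDegree
            ≤ 2 ^ K * 1 := Nat.mul_le_mul (Nat.pow_le_pow_right (by norm_num)
                (finProdFinEquiv.symm l).2.2.le) (isHomogeneous_X F _).totalDegree_le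
          _ = 2 ^ K := mul_one _
    _ = n * K * (1 + 2 ^ K) := by simp

/-- `L(permSel) ≤ L(g_M) + M² L(Sel)`. [cite: KumarRamyaSaptharishiTengse2022, §3.4] -/
theorem complexity_permSel_le :
    complexity (permSel F hmp y : MvPolynomial (Var n K M) F) ≤
      (3 * M + (M * (2 * M) + M) + 1) +
        M * M * (p * ((n * 2 ^ K * p + 1) * (2 * (n * 2 ^ K * p) + 2) + 2 * (n * K) + 1) + p) := by
  unfold permSel
  refine (complexity_aeval_le _ _).trans (add_le_add (complexity_perVNPWitness_le M F) ?_)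
  rw [Fintype.sum_sum_type]
  have h0 : ∑ j : Fin M, complexity ((Sum.elim
      (fun ab : Fin M × Fin M => liftT F (selPoly F y (permPad hmp ab)))
      (fun j : Fin M => (X (Sum.inr (Sum.inr j)) : MvPolynomial (Var n K M) F))) (Sum.inr j)) = 0 := by
    refine Finset.sum_eq_zero fun j _ => ?_
    simp only [Sum.elim_inr]
    exact complexity_X_holds (k := F) _
  rw [h0, add_zero]
  calc _ ≤ ∑ _ab : Fin M × Fin M,
        (p * ((n * 2 ^ K * p + 1) * (2 * (n * 2 ^ K * p) + 2) + 2 * (n * K) + 1) + p) := by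
        refine Finset.sum_le_sum fun ab _ => ?_
        simp only [Sum.elim_inl]
        unfold liftT
        exact (complexity_rename_le_holds' _ _).trans (complexity_selPoly_le F y _)
    _ = M * M * (p * ((n * 2 ^ K * p + 1) * (2 * (n * 2 ^ K * p) + 2) + 2 * (n * K) + 1) + p) := by
        rw [Finset.sum_const, smul_eq_mul, Finset.card_univ, Fintype.card_prod, Fintype.card_fin]

/-- `deg(permSel) ≤ 3M (n 2^K p + 1)`. [cite: KumarRamyaSaptharishiTengse2022, §3.4] -/
theorem totalDegree_permSel_le :
    (permSel F hmp y : MvPolynomial (Var n K M) F).totalDegree ≤ 3 * M * (n * 2 ^ K * p + 1) := by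
  unfold permSel
  refine (Literature.RingTheory.Nullstellensatz.totalDegree_aeval_le _ (δ := n * 2 ^ K * p + 1)
    (fun v => ?_) _).trans (Nat.mul_le_mul_right _ (totalDegree_perVNPWitness_le M F))
  rcases v with ab | j
  · simp only [Sum.elim_inl]
    unfold liftT
    exact (totalDegree_rename_le _ _).trans ((totalDegree_selPoly_le F y _).trans (Nat.le_succ _))
  · simp only [Sum.elim_inr]
    exact (isHomogeneous_X F _).totalDegree_le.trans (by omega)

variable [CharZero F]

/-- **Size of the witness**: `≤ witnessBound n K p M`. [cite: KumarRamyaSaptharishiTengse2022, §3.4] -/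
theorem complexity_witness_le :
    complexity (witness F hmp y : MvPolynomial (Var n K M) F) ≤ witnessBound n K p M := by
  unfold witness witnessBound
  refine (complexity_mul_le_holds _ _).trans ?_
  refine add_le_add (add_le_add ((complexity_mul_le_holds _ _).trans ?_) (complexity_permSel_le hmp y)) le_rfl
  refine add_le_add (add_le_add ?_ (complexity_monSel_le (F := F))) le_rfl
  unfold liftT
  exact (complexity_rename_le_holds' _ _).trans (complexity_degIndicator_le F)

/-- **Degree of the witness**: `≤ witnessDegBound n K p M`. [cite: KumarRamyaSaptharishiTengse2022, §3.4] -/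
theorem totalDegree_witness_le :
    (witness F hmp y : MvPolynomial (Var n K M) F).totalDegree ≤ witnessDegBound n K p M := by
  unfold witness witnessDegBound
  refine (totalDegree_mul _ _).trans (add_le_add ((totalDegree_mul _ _).trans (add_le_add ?_
    (totalDegree_monSel_le (F := F)))) (totalDegree_permSel_le hmp y))
  unfold liftT
  exact (totalDegree_rename_le _ _).trans (totalDegree_degIndicator_le F)

/-! #### Packaging: a Boolean sum over `Fin u` -/

/-- The number of Boolean variables: `u = nK + M`. [cite: KumarRamyaSaptharishiTengse2022, §3.4] -/
theorem card_blk : Fintype.card (Blk n K M) = n * K + M := by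
  simp

/-- **KRST §3.4, packaged**: for `n < 2^K` there is ONE polynomial `H` in the variables
`x ⊕ Fin u`, `u = nK + M`, with `boolSum H = Σ_{|μ|≤n} Perm_[p](y ∘ S_μ) x^μ`,
`L(H) ≤ witnessBound n K p M` and `deg H ≤ witnessDegBound n K p M`.
[cite: KumarRamyaSaptharishiTengse2022, §3.4] -/
theorem exists_boolSum_eq_target (hK : n < 2 ^ K) :
    ∃ H : MvPolynomial (Fin n ⊕ Fin (Fintype.card (Blk n K M))) F,
      boolSum H = target F hmp y n ∧ complexity H ≤ witnessBound n K p M ∧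
        H.totalDegree ≤ witnessDegBound n K p M := by
  classical
  set ε : Blk n K M ≃ Fin (Fintype.card (Blk n K M)) := Fintype.equivFin _ with hε
  refine ⟨rename (Sum.map id ε) (witness F hmp y), ?_, ?_, ?_⟩
  · rw [← sum_aeval_witness hmp y hK]
    unfold boolSum
    refine Fintype.sum_equiv (Equiv.arrowCongr ε (Equiv.refl Bool)).symm _ _ fun e => ?_
    have hf : ((Sum.elim X fun j => if e j then (1 : MvPolynomial (Fin n) F) else 0) ∘ Sum.map id ε) =
        bsub F ((Equiv.arrowCongr ε (Equiv.refl Bool)).symm e) := by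
      funext v
      rcases v with i | b
      · simp [bsub]
      · simp [bsub, Equiv.arrowCongr]
    rw [aeval_rename, hf]
  · exact (complexity_rename_le_holds' _ _).trans (complexity_witness_le hmp y)
  · exact (totalDegree_rename_le _ _).trans (totalDegree_witness_le hmp y)

end Bounds

end KRSTSucc

end Literature.Computability.AlgebraicComplexity

end
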